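import Literature.Geometry.Lorentzian.KerrSchildSlabDivergence
import Literature.Geometry.Lorentzian.MinkowskiRadialMultiplier
import Mathlib.Analysis.SpecialFunctions.SmoothTransition

/-!
# Crux `AdiabaticMultiKerrILED` (line `Sketch`) — the slab divergence identity under `L¹` hypotheses

Helper file for the crux `stmt-FinalStateConjecture-14310`
(`Summit.FinalStateConjecture.FinalStateConjecture.Theses.ClusterCompleteness.AdiabaticMultiKerrILED`),
far-field stub `stub_farTransport`. The tree's slab identity
`E4.integral_sub_eq_integral_divergence` (`KerrSchildSlabDivergence.lean`) asks the `C¹` current to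
vanish outside a cylinder. The far-field Morawetz current of a finite-energy solution does not; this
file removes the cut-off at spatial infinity:

* `slab_identity_of_integrable` — for a `C¹` current `J` on `ℝ⁴` whose components are integrable on
  the slab `(t₀, t₁] × ℝ³`, whose coordinate divergence is integrable there, and whose time component
  is integrable on the two boundary slices,
  `∫ J⁰(t₁, y) dy − ∫ J⁰(t₀, y) dy = ∫_{(t₀, t₁]} ∫ (∑_μ ∂_μ J^μ)(t, y) dy dt`
  (apply the compact-support identity to `f_n J`, `f_n(x) = smoothTransition (2 − ‖x⃗‖²/n²)`, and let
  `n → ∞` by dominated convergence; `‖df_n‖ ≤ C/n`). [folklore]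
-/

noncomputable section

-- the doubled `FinalStateConjecture.FinalStateConjecture` path component trips dupNamespace
set_option linter.dupNamespace false

open scoped ContDiff Topology
open Filter Set MeasureTheory Literature.Geometry.Lorentzian

namespace Summit.FinalStateConjecture.FinalStateConjecture.Cruxes.AdiabaticMultiKerrILED.Sketch

/-! ### A bound for the derivative of `smoothTransition` -/

/-- `deriv smoothTransition` is bounded on `ℝ` (it is continuous and vanishes off `[0, 1]`).
[folklore] -/
theorem exists_abs_deriv_smoothTransition_le : ∃ C : ℝ, 0 ≤ C ∧ ∀ σ : ℝ, |deriv Real.smoothTransition σ| ≤ C := by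
  have hc : Continuous (deriv Real.smoothTransition) :=
    Real.smoothTransition.contDiff.continuous_deriv le_rfl
  obtain ⟨C, hC⟩ := (isCompact_Icc (a := (-1 : ℝ)) (b := 2)).exists_bound_of_continuousOn hc.continuousOn
  refine ⟨max C 0, le_max_right _ _, fun σ ↦ ?_⟩
  by_cases hσ : σ ∈ Icc (-1 : ℝ) 2
  · have := hC σ hσ
    rw [Real.norm_eq_abs] at this
    exact this.trans (le_max_left _ _)
  · -- outside `[-1, 2]` the function is locally constant
    have hzero : deriv Real.smoothTransition σ = 0 := by
      rw [mem_Icc, not_and_or, not_le, not_le] at hσ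
      rcases hσ with h | h
      · have hev : Real.smoothTransition =ᶠ[𝓝 σ] fun _ ↦ (0 : ℝ) :=
          Filter.eventually_of_mem (Iio_mem_nhds (by linarith : σ < 0)) fun s hs ↦
            Real.smoothTransition.zero_of_nonpos (le_of_lt hs)
        rw [hev.deriv_eq]; simp
      · have hev : Real.smoothTransition =ᶠ[𝓝 σ] fun _ ↦ (1 : ℝ) :=
          Filter.eventually_of_mem (Ioi_mem_nhds (by linarith : 1 < σ)) fun s hs ↦
            Real.smoothTransition.one_of_one_le (le_of_lt hs)
        rw [hev.deriv_eq]; simp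
    rw [hzero, abs_zero]
    exact le_max_right _ _

/-! ### The scaled spatial cut-off -/

/-- The cut-off `f_L(x) = smoothTransition (2 − ‖x⃗‖²/L²)` is smooth. [folklore] -/
theorem contDiff_spatialCutoff (L : ℝ) :
    ContDiff ℝ 1 fun x : E4 ↦ Real.smoothTransition (2 - E4.spatialNorm x ^ 2 / L ^ 2) := by
  refine Real.smoothTransition.contDiff.comp ?_
  have hs : ContDiff ℝ 1 fun x : E4 ↦ E4.spatialNorm x ^ 2 := by
    rw [show (fun x : E4 ↦ E4.spatialNorm x ^ 2) = fun x ↦ x 1 ^ 2 + x 2 ^ 2 + x 3 ^ 2 from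
      funext E4.spatialNorm_sq]
    fun_prop
  exact contDiff_const.sub (hs.div_const _)

/-- `f_L = 1` on `{‖x⃗‖ ≤ L}` (`L > 0`). [folklore] -/
theorem spatialCutoff_eq_one {L : ℝ} (hL : 0 < L) {x : E4} (hx : E4.spatialNorm x ≤ L) :
    Real.smoothTransition (2 - E4.spatialNorm x ^ 2 / L ^ 2) = 1 := by
  apply Real.smoothTransition.one_of_one_le
  have h1 : E4.spatialNorm x ^ 2 ≤ L ^ 2 := pow_le_pow_left₀ (E4.spatialNorm_nonneg x) hx 2
  have h2 : E4.spatialNorm x ^ 2 / L ^ 2 ≤ 1 := by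
    rw [div_le_one (by positivity)]; exact h1
  linarith

/-- `f_L = 0` on `{2L ≤ ‖x⃗‖}` (`L > 0`). [folklore] -/
theorem spatialCutoff_eq_zero {L : ℝ} (hL : 0 < L) {x : E4} (hx : 2 * L ≤ E4.spatialNorm x) :
    Real.smoothTransition (2 - E4.spatialNorm x ^ 2 / L ^ 2) = 0 := by
  apply Real.smoothTransition.zero_of_nonpos
  have h1 : (2 * L) ^ 2 ≤ E4.spatialNorm x ^ 2 := pow_le_pow_left₀ (by positivity) hx 2
  have h2 : 4 ≤ E4.spatialNorm x ^ 2 / L ^ 2 := by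
    rw [le_div_iff₀ (by positivity)]; nlinarith
  linarith

/-- `0 ≤ f_L ≤ 1`. [folklore] -/
theorem spatialCutoff_mem (L : ℝ) (x : E4) :
    0 ≤ Real.smoothTransition (2 - E4.spatialNorm x ^ 2 / L ^ 2) ∧
      Real.smoothTransition (2 - E4.spatialNorm x ^ 2 / L ^ 2) ≤ 1 :=
  ⟨Real.smoothTransition.nonneg _, Real.smoothTransition.le_one _⟩

/-- **Gradient bound `‖∂_μ f_L‖ ≤ 4 C_θ / L`** for `L ≥ 1`, with `C_θ` a bound for
`|smoothTransition'|`: `∂_μ f_L = θ'(2 − s/L²) · (−∂_μ s / L²)`, `|∂_μ s| ≤ 2‖x⃗‖ < 4L` where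
`θ' ≠ 0` (`s/L² < 2`). [folklore] -/
theorem abs_fderiv_spatialCutoff_le {C : ℝ} (hC0 : 0 ≤ C)
    (hC : ∀ σ : ℝ, |deriv Real.smoothTransition σ| ≤ C) {L : ℝ} (hL : 1 ≤ L) (x : E4) (μ : Fin 4) :
    |fderiv ℝ (fun z : E4 ↦ Real.smoothTransition (2 - E4.spatialNorm z ^ 2 / L ^ 2)) x
        (E4.basisVector μ)| ≤ 4 * C / L := by
  have hLpos : 0 < L := by linarith
  -- the inner affine-quadratic map and its derivative along `∂_μ`
  set a : E4 → ℝ := fun z ↦ 2 - E4.spatialNorm z ^ 2 / L ^ 2 with ha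
  have hs0 := KerrSchild.hasFDerivAt_spatialNormSq x
  have ha' : HasFDerivAt a (-((L ^ 2)⁻¹ • ((2 * x 1) • E4.dx 1 + (2 * x 2) • E4.dx 2 +
      (2 * x 3) • E4.dx 3))) x := by
    have h := (hs0.const_mul (L ^ 2)⁻¹).const_sub 2
    have hfun : a = fun z ↦ 2 - (L ^ 2)⁻¹ * E4.spatialNorm z ^ 2 := by
      funext z; simp only [ha]; ring
    rw [hfun]
    exact h
  have haμ : fderiv ℝ a x (E4.basisVector μ) = -((L ^ 2)⁻¹ * (if μ = 0 then 0 else 2 * x μ)) := by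
    rw [ha'.fderiv]
    have hsμ := KerrSchild.fderiv_spatialNormSq_apply x μ
    rw [hs0.fderiv] at hsμ
    simp only [neg_apply, smul_apply, smul_eq_mul, hsμ]
  have hθ : HasDerivAt Real.smoothTransition (deriv Real.smoothTransition (a x)) (a x) :=
    (((Real.smoothTransition.contDiff (n := 1)).differentiable one_ne_zero) _).hasDerivAt
  have hcomp : HasFDerivAt (fun z : E4 ↦ Real.smoothTransition (a z))
      (deriv Real.smoothTransition (a x) • -((L ^ 2)⁻¹ • ((2 * x 1) • E4.dx 1 + (2 * x 2) • E4.dx 2 +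
        (2 * x 3) • E4.dx 3))) x := hθ.comp_hasFDerivAt x ha'
  have hval : fderiv ℝ (fun z : E4 ↦ Real.smoothTransition (a z)) x (E4.basisVector μ) =
      deriv Real.smoothTransition (a x) * fderiv ℝ a x (E4.basisVector μ) := by
    rw [hcomp.fderiv, ha'.fderiv]
    simp only [smul_apply, smul_eq_mul]
  show |fderiv ℝ (fun z : E4 ↦ Real.smoothTransition (a z)) x (E4.basisVector μ)| ≤ 4 * C / L
  rw [hval, haμ]
  -- where `θ' ≠ 0` we have `‖x⃗‖ < 2 L`
  by_cases hfar : 2 * L ^ 2 ≤ E4.spatialNorm x ^ 2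
  · have harg : a x ≤ 0 := by
      simp only [ha, sub_nonpos, le_div_iff₀ (by positivity : (0 : ℝ) < L ^ 2)]; linarith
    have hzero : deriv Real.smoothTransition (a x) = 0 := by
      have hc : Continuous (deriv Real.smoothTransition) :=
        Real.smoothTransition.contDiff.continuous_deriv le_rfl
      have hzero' : ∀ s < (0 : ℝ), deriv Real.smoothTransition s = 0 := fun s hs ↦ by
        have hev : Real.smoothTransition =ᶠ[𝓝 s] fun _ ↦ (0 : ℝ) :=
          Filter.eventually_of_mem (Iio_mem_nhds hs) fun r hr ↦
            Real.smoothTransition.zero_of_nonpos (le_of_lt hr)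
        rw [hev.deriv_eq]; simp
      have hclos : a x ∈ closure (Iio (0 : ℝ)) := by rw [closure_Iio]; exact harg
      exact (isClosed_eq hc continuous_const).closure_subset_iff.mpr (fun s hs ↦ hzero' s hs) hclos
    rw [hzero, zero_mul, abs_zero]
    positivity
  · rw [not_le] at hfar
    have hsn : E4.spatialNorm x < 2 * L := by
      have h0 := E4.spatialNorm_nonneg x
      nlinarith
    have hxμ : |(if μ = 0 then (0 : ℝ) else 2 * x μ)| ≤ 2 * E4.spatialNorm x := by
      have h0 := E4.spatialNorm_nonneg x
      have hsq := E4.spatialNorm_sq x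
      by_cases hμ : μ = 0
      · simp [hμ]; positivity
      · simp only [hμ, if_false, abs_mul, abs_two]
        have : |x μ| ≤ E4.spatialNorm x := by
          rw [← Real.sqrt_sq_eq_abs, show E4.spatialNorm x = Real.sqrt (E4.spatialNorm x ^ 2) from
            (Real.sqrt_sq h0).symm, hsq]
          apply Real.sqrt_le_sqrt
          fin_cases μ
          · exact absurd rfl hμ
          all_goals simp; nlinarith [sq_nonneg (x 1), sq_nonneg (x 2), sq_nonneg (x 3)]
        linarith
    calc |deriv Real.smoothTransition (a x) * -((L ^ 2)⁻¹ * (if μ = 0 then 0 else 2 * x μ))|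
        = |deriv Real.smoothTransition (a x)| * ((L ^ 2)⁻¹ * |(if μ = 0 then (0 : ℝ) else 2 * x μ)|) := by
          rw [abs_mul, abs_neg, abs_mul, abs_of_pos (by positivity : (0 : ℝ) < (L ^ 2)⁻¹)]
      _ ≤ C * ((L ^ 2)⁻¹ * (2 * (2 * L))) := by
          gcongr
          · exact hC _
          · exact hxμ.trans (by linarith)
      _ = 4 * C / L := by field_simp; ring

/-! ### The identity -/

/-- **The slab divergence identity under `L¹` hypotheses.** Let `J = (J^μ)` be a `C¹` current on
`ℝ⁴`, `t₀ ≤ t₁`, with `J⁰(t₀, ·)`, `J⁰(t₁, ·) ∈ L¹(ℝ³)`, every component integrable on the slab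
`(t₀, t₁] × ℝ³`, and the coordinate divergence `∑_μ ∂_μ J^μ` integrable there. Then
`∫ J⁰(t₁, y) dy − ∫ J⁰(t₀, y) dy = ∫_{(t₀, t₁]} ∫ (∑_μ ∂_μ J^μ)(t, y) dy dt`. [folklore] -/
theorem slab_identity_of_integrable :
    ∀ (J : Fin 4 → E4 → ℝ) (t₀ t₁ : ℝ), t₀ ≤ t₁ → (∀ μ, ContDiff ℝ 1 (J μ)) →
      Integrable (fun y : E3 ↦ J 0 (E4.ofTimeSpace t₀ y)) →
      Integrable (fun y : E3 ↦ J 0 (E4.ofTimeSpace t₁ y)) →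
      (∀ μ, Integrable (fun q : ℝ × E3 ↦ J μ (E4.ofTimeSpace q.1 q.2))
        ((volume.restrict (Ioc t₀ t₁)).prod volume)) →
      Integrable (fun q : ℝ × E3 ↦ ∑ μ, fderiv ℝ (J μ) (E4.ofTimeSpace q.1 q.2) (E4.basisVector μ))
        ((volume.restrict (Ioc t₀ t₁)).prod volume) →
      (∫ y, J 0 (E4.ofTimeSpace t₁ y)) - ∫ y, J 0 (E4.ofTimeSpace t₀ y) =
        ∫ t in Ioc t₀ t₁, ∫ y, ∑ μ, fderiv ℝ (J μ) (E4.ofTimeSpace t y) (E4.basisVector μ) := by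
  intro J t₀ t₁ h01 hJ1 hint₀ hint₁ hslab hdiv
  -- notation
  obtain ⟨C, hC0, hC⟩ := exists_abs_deriv_smoothTransition_le
  set μP : Measure (ℝ × E3) := (volume.restrict (Ioc t₀ t₁)).prod volume with hμP
  set f : ℕ → E4 → ℝ := fun n x ↦ Real.smoothTransition (2 - E4.spatialNorm x ^ 2 / ((n : ℝ) + 1) ^ 2)
    with hf
  have hn1 : ∀ n : ℕ, (1 : ℝ) ≤ (n : ℝ) + 1 := fun n ↦ by
    have := (Nat.cast_nonneg n : (0 : ℝ) ≤ n); linarith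
  have hnpos : ∀ n : ℕ, (0 : ℝ) < (n : ℝ) + 1 := fun n ↦ by linarith [hn1 n]
  have hf1 : ∀ n, ContDiff ℝ 1 (f n) := fun n ↦ contDiff_spatialCutoff _
  have hf01 : ∀ n x, 0 ≤ f n x ∧ f n x ≤ 1 := fun n x ↦ spatialCutoff_mem _ x
  have hfabs : ∀ n x, |f n x| ≤ 1 := fun n x ↦ by
    rw [abs_of_nonneg (hf01 n x).1]; exact (hf01 n x).2
  have hdf : ∀ n x μ, |fderiv ℝ (f n) x (E4.basisVector μ)| ≤ 4 * C / ((n : ℝ) + 1) :=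
    fun n x μ ↦ abs_fderiv_spatialCutoff_le hC0 hC (hn1 n) x μ
  have hdf' : ∀ n x μ, |fderiv ℝ (f n) x (E4.basisVector μ)| ≤ 4 * C := fun n x μ ↦
    (hdf n x μ).trans (div_le_self (by positivity) (hn1 n))
  have hJd : ∀ μ x, DifferentiableAt ℝ (J μ) x := fun μ x ↦ (hJ1 μ).differentiable one_ne_zero x
  have hfd : ∀ n x, DifferentiableAt ℝ (f n) x := fun n x ↦ (hf1 n).differentiable one_ne_zero x
  -- the cut-off currents and their divergence
  set Jn : ℕ → Fin 4 → E4 → ℝ := fun n μ x ↦ f n x * J μ x with hJn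
  have hJn1 : ∀ n μ, ContDiff ℝ 1 (Jn n μ) := fun n μ ↦ (hf1 n).mul (hJ1 μ)
  have hdivJn : ∀ n x, ∑ μ, fderiv ℝ (Jn n μ) x (E4.basisVector μ) =
      f n x * (∑ μ, fderiv ℝ (J μ) x (E4.basisVector μ)) +
        ∑ μ, fderiv ℝ (f n) x (E4.basisVector μ) * J μ x := by
    intro n x
    rw [Finset.mul_sum, ← Finset.sum_add_distrib]
    refine Finset.sum_congr rfl fun μ _ ↦ ?_
    have h' : HasFDerivAt (fun y ↦ f n y * J μ y)
        (f n x • fderiv ℝ (J μ) x + J μ x • fderiv ℝ (f n) x) x :=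
      (hfd n x).hasFDerivAt.mul (hJd μ x).hasFDerivAt
    simp only [hJn]
    rw [h'.fderiv]
    simp only [add_apply, smul_apply, smul_eq_mul]
    ring
  -- (1) the identity for each `n` (compact spatial support)
  have hEn : ∀ n : ℕ, (∫ y, Jn n 0 (E4.ofTimeSpace t₁ y)) - ∫ y, Jn n 0 (E4.ofTimeSpace t₀ y) =
      ∫ t in Ioc t₀ t₁, ∫ y, ∑ μ, fderiv ℝ (Jn n μ) (E4.ofTimeSpace t y) (E4.basisVector μ) := by
    intro n
    refine E4.integral_sub_eq_integral_divergence (hJn1 n) (ρ := 2 * ((n : ℝ) + 1)) h01 ?_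
    intro μ t _ y hy
    simp only [hJn, hf]
    rw [spatialCutoff_eq_zero (hnpos n) (by rw [E4.spatialNorm_ofTimeSpace]; exact hy.le), zero_mul]
  -- continuity facts
  have hcts : Continuous fun q : ℝ × E3 ↦ E4.ofTimeSpace q.1 q.2 := E4.continuous_ofTimeSpace_uncurry
  have hfc : ∀ n, Continuous fun q : ℝ × E3 ↦ f n (E4.ofTimeSpace q.1 q.2) := fun n ↦
    (hf1 n).continuous.comp hcts
  have hdfc : ∀ n μ, Continuous fun q : ℝ × E3 ↦ fderiv ℝ (f n) (E4.ofTimeSpace q.1 q.2) (E4.basisVector μ) :=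
    fun n μ ↦ (((hf1 n).continuous_fderiv one_ne_zero).comp hcts).clm_apply continuous_const
  have hJc : ∀ μ, Continuous fun q : ℝ × E3 ↦ J μ (E4.ofTimeSpace q.1 q.2) := fun μ ↦
    (hJ1 μ).continuous.comp hcts
  -- (2a) boundary slices: dominated convergence
  have hslice : ∀ {t : ℝ}, Integrable (fun y : E3 ↦ J 0 (E4.ofTimeSpace t y)) →
      Tendsto (fun n ↦ ∫ y, Jn n 0 (E4.ofTimeSpace t y)) atTop (𝓝 (∫ y, J 0 (E4.ofTimeSpace t y))) := by
    intro t hint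
    refine tendsto_integral_of_dominated_convergence (fun y ↦ |J 0 (E4.ofTimeSpace t y)|)
      (fun n ↦ ?_) hint.abs (fun n ↦ Eventually.of_forall fun y ↦ ?_) (Eventually.of_forall fun y ↦ ?_)
    · exact (((hf1 n).continuous.mul (hJ1 0).continuous).comp
        (E4.continuous_ofTimeSpace t)).aestronglyMeasurable
    · simp only [hJn, Real.norm_eq_abs, abs_mul]
      exact mul_le_of_le_one_left (abs_nonneg _) (hfabs n _)
    · -- eventually `f n (t, y) = 1`
      apply tendsto_const_nhds.congr'
      filter_upwards [eventually_ge_atTop ⌈‖y‖⌉₊] with n hn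
      simp only [hJn, hf]
      rw [spatialCutoff_eq_one (hnpos n), one_mul]
      rw [E4.spatialNorm_ofTimeSpace]
      have : (⌈‖y‖⌉₊ : ℝ) ≤ n := by exact_mod_cast hn
      linarith [Nat.le_ceil ‖y‖]
  -- (2b) the bulk: split into `f_n div J` and the cut-off layer
  set D : ℝ × E3 → ℝ := fun q ↦ ∑ μ, fderiv ℝ (J μ) (E4.ofTimeSpace q.1 q.2) (E4.basisVector μ) with hD
  set Rn : ℕ → ℝ × E3 → ℝ := fun n q ↦
    ∑ μ, fderiv ℝ (f n) (E4.ofTimeSpace q.1 q.2) (E4.basisVector μ) * J μ (E4.ofTimeSpace q.1 q.2) with hRn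
  have hRn_int : ∀ n, Integrable (Rn n) μP := fun n ↦ by
    refine integrable_finsetSum _ fun μ _ ↦ ?_
    exact (hslab μ).bdd_mul (c := 4 * C) (hdfc n μ).aestronglyMeasurable
      (Eventually.of_forall fun q ↦ by rw [Real.norm_eq_abs]; exact hdf' n _ μ)
  have hfD_int : ∀ n, Integrable (fun q ↦ f n (E4.ofTimeSpace q.1 q.2) * D q) μP := fun n ↦
    hdiv.bdd_mul (c := 1) (hfc n).aestronglyMeasurable
      (Eventually.of_forall fun q ↦ by rw [Real.norm_eq_abs]; exact hfabs n _)
  have hFn_int : ∀ n, Integrable (fun q : ℝ × E3 ↦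
      ∑ μ, fderiv ℝ (Jn n μ) (E4.ofTimeSpace q.1 q.2) (E4.basisVector μ)) μP := fun n ↦ by
    have : (fun q : ℝ × E3 ↦ ∑ μ, fderiv ℝ (Jn n μ) (E4.ofTimeSpace q.1 q.2) (E4.basisVector μ)) =
        fun q ↦ f n (E4.ofTimeSpace q.1 q.2) * D q + Rn n q := by
      funext q; rw [hdivJn]
    rw [this]
    exact (hfD_int n).add (hRn_int n)
  -- iterated = product integrals
  have hiter : ∀ n, (∫ t in Ioc t₀ t₁, ∫ y, ∑ μ, fderiv ℝ (Jn n μ) (E4.ofTimeSpace t y) (E4.basisVector μ)) =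
      (∫ q, f n (E4.ofTimeSpace q.1 q.2) * D q ∂μP) + ∫ q, Rn n q ∂μP := by
    intro n
    rw [← integral_add (hfD_int n) (hRn_int n)]
    have h := integral_prod _ (hFn_int n)
    calc (∫ t in Ioc t₀ t₁, ∫ y, ∑ μ, fderiv ℝ (Jn n μ) (E4.ofTimeSpace t y) (E4.basisVector μ))
        = ∫ z, ∑ μ, fderiv ℝ (Jn n μ) (E4.ofTimeSpace z.1 z.2) (E4.basisVector μ) ∂μP := h.symm
      _ = ∫ z, (f n (E4.ofTimeSpace z.1 z.2) * D z + Rn n z) ∂μP :=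
          integral_congr_ae (Eventually.of_forall fun z ↦ hdivJn n _)
  have hiterD : (∫ t in Ioc t₀ t₁, ∫ y, ∑ μ, fderiv ℝ (J μ) (E4.ofTimeSpace t y) (E4.basisVector μ)) =
      ∫ q, D q ∂μP := (integral_prod _ hdiv).symm
  -- limit of the `f_n div J` part
  have hlimD : Tendsto (fun n ↦ ∫ q, f n (E4.ofTimeSpace q.1 q.2) * D q ∂μP) atTop (𝓝 (∫ q, D q ∂μP)) := by
    refine tendsto_integral_of_dominated_convergence (fun q ↦ |D q|) (fun n ↦ ?_) hdiv.abs
      (fun n ↦ Eventually.of_forall fun q ↦ ?_) (Eventually.of_forall fun q ↦ ?_)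
    · exact (hfD_int n).aestronglyMeasurable
    · rw [Real.norm_eq_abs, abs_mul]
      exact mul_le_of_le_one_left (abs_nonneg _) (hfabs n _)
    · apply tendsto_const_nhds.congr'
      filter_upwards [eventually_ge_atTop ⌈‖q.2‖⌉₊] with n hn
      simp only [hf]
      rw [spatialCutoff_eq_one (hnpos n), one_mul]
      rw [E4.spatialNorm_ofTimeSpace]
      have : (⌈‖q.2‖⌉₊ : ℝ) ≤ n := by exact_mod_cast hn
      linarith [Nat.le_ceil ‖q.2‖]
  -- the layer part tends to zero
  have hlimR : Tendsto (fun n ↦ ∫ q, Rn n q ∂μP) atTop (𝓝 0) := by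
    set K : ℝ := ∑ μ, ∫ q, |J μ (E4.ofTimeSpace q.1 q.2)| ∂μP with hK
    have hbound : ∀ n, ‖∫ q, Rn n q ∂μP‖ ≤ 4 * C * K / ((n : ℝ) + 1) := by
      intro n
      calc ‖∫ q, Rn n q ∂μP‖ ≤ ∫ q, ‖Rn n q‖ ∂μP := norm_integral_le_integral_norm _
        _ ≤ ∫ q, (4 * C / ((n : ℝ) + 1)) * ∑ μ, |J μ (E4.ofTimeSpace q.1 q.2)| ∂μP := by
            refine integral_mono (hRn_int n).norm ?_ fun q ↦ ?_
            · exact (integrable_finsetSum _ fun μ _ ↦ (hslab μ).abs).const_mul _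
            · rw [Real.norm_eq_abs, hRn, Finset.mul_sum]
              refine (Finset.abs_sum_le_sum_abs _ _).trans (Finset.sum_le_sum fun μ _ ↦ ?_)
              rw [abs_mul]
              exact mul_le_mul_of_nonneg_right (hdf n _ μ) (abs_nonneg _)
        _ = 4 * C * K / ((n : ℝ) + 1) := by
            rw [integral_const_mul, integral_finsetSum _ fun μ _ ↦ (hslab μ).abs, hK]
            ring
    have hzero : Tendsto (fun n : ℕ ↦ 4 * C * K / ((n : ℝ) + 1)) atTop (𝓝 0) := by
      have h := tendsto_const_div_atTop_nhds_zero_nat (4 * C * K)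
      have h' : Tendsto (fun n : ℕ ↦ 4 * C * K / ((n + 1 : ℕ) : ℝ)) atTop (𝓝 0) :=
        h.comp (tendsto_add_atTop_nat 1)
      refine h'.congr fun n ↦ ?_
      push_cast; ring
    exact squeeze_zero_norm hbound hzero
  -- (3) conclude by uniqueness of limits
  have hL : Tendsto (fun n ↦ (∫ y, Jn n 0 (E4.ofTimeSpace t₁ y)) - ∫ y, Jn n 0 (E4.ofTimeSpace t₀ y))
      atTop (𝓝 ((∫ y, J 0 (E4.ofTimeSpace t₁ y)) - ∫ y, J 0 (E4.ofTimeSpace t₀ y))) :=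
    (hslice hint₁).sub (hslice hint₀)
  have hR : Tendsto (fun n ↦ (∫ y, Jn n 0 (E4.ofTimeSpace t₁ y)) - ∫ y, Jn n 0 (E4.ofTimeSpace t₀ y))
      atTop (𝓝 (∫ q, D q ∂μP)) := by
    have h : Tendsto (fun n ↦ (∫ q, f n (E4.ofTimeSpace q.1 q.2) * D q ∂μP) + ∫ q, Rn n q ∂μP) atTop
        (𝓝 ((∫ q, D q ∂μP) + 0)) := hlimD.add hlimR
    rw [add_zero] at h
    refine h.congr fun n ↦ ?_
    rw [← hiter n, hEn n]
  rw [hiterD]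
  exact tendsto_nhds_unique hL hR

end Summit.FinalStateConjecture.FinalStateConjecture.Cruxes.AdiabaticMultiKerrILED.Sketch

end
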